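import Summits.QuantumFields.YangMills.Theorems.BalabanUVNodesN18FiniteVolumeLettersModel
import Summits.QuantumFields.YangMills.Theorems.BalabanUVNodesN18BetaOfRecordBoxDegeneracySplitForm

/-!
# BalabanUVNodes ∕ N18 — THE MIXED TWO-BOND MODEL, PART 1: def-B's (1.20)–(1.22) β-map `ℰ ↦ betaMerged F ℰ ρ bV` REALIZES EVERY history-dependent
# β-function `β : HBeta` (model level) — so β CAN RUN with the couplings through the ACTUAL Hessian ∕ window ∕ second-moment definitions; β-side letters transported
# (Track A, DAG node N18 = NE5; key K3⁷ `SpineGivenEndpointR13SepCoPH` = stmt-QuantumFields-20544, skeleton v5 941dddb108cbaacf; cell `pub-ymgap`, WIDTH SEAT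
# `pub-ymgap-dag-n18-w2` g7; `--supports stmt-QuantumFields-20544 --as helper`, COUNT-NEUTRAL; definition lane: four small `def`s, the rest theorems; 0 `sorry`)

WHY.  dag-n18-w2 g6's fading-memory ON-SITE model (`…N18FiniteVolumeLettersModel`, p609711) met W1-19b's finite-volume kernel letters jointly while its (1.22) β was
IDENTICALLY ZERO (a direction-`0` on-site Hessian has no `Π₀₁` entry), and named the successor: a family whose β genuinely RUNS.  THIS FILE settles the β-side
completely, for EVERY amplitude law at once.  The MIXED TWO-BOND functional `W ↦ a k v · W 0 x_e · W 1 x_0` (a direction-`0` bond at the window image `x_e` of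
`e ∈ ℤ⁴` times the direction-`1` bond at the origin, weighted by an arbitrary history-dependent amplitude `a : HBeta`) has chart `B ↦ a·e^{B 0 x_e + B 1 x_0}` — the
product of two exponentials is the exponential of a LINEAR form — so its (1.20) Hessian is `a·(ev₁ + ev₂) ⊗ (ev₁ + ev₂)` WITH MIXED ENTRIES (§1); def-B's windowed kernel
is computed in closed form, the torus window separates distinct integer vectors eventually in `K`, the (1.21) limit is `crossKernel (a k v) e` with `Π₀₁(z) = a k v·[z = e]`,
and the (1.22) second moment is ★★ `betaMerged F (crossTermFamily F a e) … = (k, v) ↦ a k v · e₀e₁` by `tsum_eq_single` (§2).  At the diagonal separation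
`e = (1,1,0,0)`: ★★★ `betaMerged_crossTermFamily_diag01 : betaMerged F (crossTermFamily F β diag01) … = β` for EVERY `β : HBeta` — def-B's β-map is ONTO at model
level (`exists_termFamily_betaMerged_eq`).  Consequently (§3) every β-side letter satisfiable on `HBeta` is satisfiable THROUGH def-B's machinery by a scalar term family:
`¬ BoxwiseConstant` (n18-w2 g0's degeneracy shape, merged and split currency, ANY one-loop numbers `β0`), g2's `RemainderNonvanishingOnBoxes`, def-B's `Beta0LimitExists`
∕ `beta0OfMerged` (equal to `β`'s), g2's anchored linear witness `b k + v_k` (`exists_termFamily_anchor_and_remainderNonvanishingOnBoxes`), and ★ p592505's guard lemma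
`sensitiveOnBoxes_objects_of_not_boxwiseConstant` APPLIED WITH AN INHABITED ANTECEDENT (№189 A6 for that lemma, non-vacuously: `sensitiveOnBoxes_objects_cross`).
PART 2 (`…RunningBetaLettersModelNodes`) carries W1-19b's kernel letters from letters ON THE AMPLITUDE LAW and the fading-amplitude instance at node U3's objects.

LOCATED MORAL (for № 13 ∕ the guard record, complementing g6's): the SHAPE of def-B's (1.20)–(1.22) definitions excludes NO history dependence of β whatsoever — every
β-side letter displayed anywhere in the tree (running, anchoring, signs, one-sided limits, non-degeneracy) is pure CONTENT about Bałaban's specific merged term (1.6).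

HONEST FRAMING.  MODEL LEVEL (scalar algebra `𝔄 = V = ℝ`, chart `ρ = id`, one-colour basis `Module.Basis.singleton Unit ℝ`; the two-bond functional is a test object):
NOT Bałaban's merged term (1.6); inhabits NO letter OF RECORD (`…OfRecord₁₃` read `θ`'s own term data), NOT `Provisos₁₃CoPH` (K0⁷ OPEN); `¬ BoxwiseConstant θ.γ β₁₃`
AT THE RECORD neither proved nor refuted (unprinted two-loop content); nothing of Bałaban's asserted; NE5 NOT PRINTED for d = 4; N18 ∕ N22 ∕ (D4) NOT discharged; K3⁷
OPEN, not claimed; counts UNMOVED (typed 28∕28 · discharged 5∕27, A 5∕28 — the chair's single count line is the only count); one finite 𝕋⁴ programme at fixed ε — R4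
closes the CONDITIONAL rung `BalabanLadder.UV` only: NOT ℝ⁴ ∕ infinite volume ∕ OS ∕ mass gap; the YM mass gap (Clay) is NOT proved by any of this.  Nothing landed edited.

Sources (types only): [Balaban1987RG1] CMP **109** (1987) (1.20)–(1.22) p. 264, (2.12)–(2.14) p. 268, (5.10) p. 293; [Balaban1988RG2Cluster] CMP **116** (2.13)–(2.14).
-/

noncomputable section

open Filter Topology
open scoped BigOperators

namespace YMDAG.N18.RunningBetaLettersModel

open Literature.MathematicalPhysics.QuantumFieldTheory.Balaban1983to89
open Literature.MathematicalPhysics.QuantumFieldTheory.Balaban1983to89.T4Continuum (T4Family)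
open Literature.MathematicalPhysics.QuantumFieldTheory.Balaban1983to89.T4OutputRate (Window NE9)
open Literature.MathematicalPhysics.QuantumFieldTheory.Balaban1983to89.FlowStep (Box HBeta)
open Literature.MathematicalPhysics.QuantumFieldTheory.Balaban1983to89.T4FlagMemory (extd)
open Literature.MathematicalPhysics.QuantumFieldTheory.Balaban1983to89.B12PolarizationTensor120 (polTensor polComp expChart)
open Literature.MathematicalPhysics.QuantumFieldTheory.Balaban1983to89.Node00 (TermFamily1 siteOfInt polScalar polWindow polLimit PolLimitExists Stage13Params
  U3Letters₁₁ betaMerged betaOfMerged beta0OfMerged Beta0LimitExists)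
open Literature.MathematicalPhysics.QuantumFieldTheory.Balaban1983to89.Node00.U3OfKernels (histPrefix kernelA EA objects KernelDecay)
open Literature.MathematicalPhysics.QuantumFieldTheory.Balaban1983to89.Node00.U3KernelLetters (PolLimitsExist GeometricIncrements WindowedDecay WindowedNE9
  WindowedStepRate KernelStepRate)
open Literature.MathematicalPhysics.QuantumFieldTheory.Balaban1983to89.B12Sec2to5 (l1)
open YMDAG.UVSplit (N18At N22At u3OfRecord₁₃)
open YMDAG.N18.U3Guards (SensitiveOnBoxes BoxwiseConstant)
open YMDAG.N18.BetaBoxDegeneracy (RemainderNonvanishingOnBoxes)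
open Literature.MathematicalPhysics.QuantumFieldTheory.Balaban1983to89.B12Beta (HistBox)
open YMDAG.N18.FiniteVolumeLettersModel (bondEval bondEval_apply siteOfInt_eventually_ne)

/-! ## §1 The calculus fact: the (1.20) Hessian of the chart of a PRODUCT of two bond evaluations has mixed entries -/

section Calculus

variable {Λ T : Type*} [Fintype Λ] [Fintype T]

/-- First derivative of `B ↦ c · e^{L B}` for a continuous linear functional `L` of the bond field: `(c · e^{L B}) • L`. [folklore] -/
theorem hasFDerivAt_constMulExp (c : ℝ) (L : (Λ → T → ℝ) →L[ℝ] ℝ) (B : Λ → T → ℝ) :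
    HasFDerivAt (fun B : Λ → T → ℝ => c * Real.exp (L B)) ((c * Real.exp (L B)) • L) B :=
  ((Real.hasDerivAt_exp (L B)).const_mul c).comp_hasFDerivAt B L.hasFDerivAt

/-- The derivative as a function. [folklore] -/
theorem fderiv_constMulExp (c : ℝ) (L : (Λ → T → ℝ) →L[ℝ] ℝ) :
    fderiv ℝ (fun B : Λ → T → ℝ => c * Real.exp (L B)) = fun B => (c * Real.exp (L B)) • L :=
  funext fun B => (hasFDerivAt_constMulExp c L B).fderiv

/-- Second derivative of `B ↦ c · e^{L B}` at `B = 0`: `(c • L) ⊗ L` (as `smulRight`). [folklore] -/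
theorem hasFDerivAt_fderiv_constMulExp (c : ℝ) (L : (Λ → T → ℝ) →L[ℝ] ℝ) :
    HasFDerivAt (fderiv ℝ (fun B : Λ → T → ℝ => c * Real.exp (L B))) (((c * Real.exp (L 0)) • L).smulRight L) 0 := by
  rw [fderiv_constMulExp]
  exact (hasFDerivAt_constMulExp c L 0).smul_const L

omit [Fintype Λ] [Fintype T] in
/-- The chart `B ↦ ℰ(exp B)` of the TWO-BOND functional `ℰ W = c · W μ₁ x₁ · W μ₂ x₂` (scalar algebra, `ρ = id`) is `B ↦ c · e^{B μ₁ x₁ + B μ₂ x₂}` — the product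
of two exponentials is the exponential of a LINEAR form of the bond field. [cite: Balaban1987RG1, p.264 (before (1.20)); model] -/
theorem expChart_crossMul (c : ℝ) (μ₁ : Λ) (x₁ : T) (μ₂ : Λ) (x₂ : T) :
    expChart (F := ℝ) (fun W : Λ → T → ℝ => c * (W μ₁ x₁ * W μ₂ x₂)) (ContinuousLinearMap.id ℝ ℝ) =
      fun B => c * Real.exp ((bondEval μ₁ x₁ + bondEval μ₂ x₂) B) := by
  funext B
  simp [expChart, Real.exp_eq_exp_ℝ, NormedSpace.exp_add]

omit [Fintype Λ] [Fintype T] in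
/-- `(δ_{μ,x} v)(μ', x') = v` if `(μ, x) = (μ', x')`, else `0`. [folklore] -/
theorem single_single_apply [DecidableEq Λ] [DecidableEq T] (μ : Λ) (x : T) (v : ℝ) (μ' : Λ) (x' : T) :
    (Pi.single μ (Pi.single x v) : Λ → T → ℝ) μ' x' = if μ = μ' ∧ x = x' then v else 0 := by
  by_cases h : μ = μ'
  · subst h
    by_cases h' : x = x'
    · subst h'; simp
    · simp [h', Ne.symm h']
  · simp [h, Ne.symm h]

/-- ★ **THE (1.20) HESSIAN OF THE CHART OF A TWO-BOND PRODUCT**: for `ℰ W = c · W μ₁ x₁ · W μ₂ x₂` (scalar configurations),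
`Π(v_{μ,x} ⊗ w_{ν,y}) = c · ((δ_{μ,x}v)(μ₁,x₁) + (δ_{μ,x}v)(μ₂,x₂)) · ((δ_{ν,y}w)(μ₁,x₁) + (δ_{ν,y}w)(μ₂,x₂))` — the two bonds ARE COUPLED (mixed entries).
[cite: Balaban1987RG1, (1.20) p.264; model] -/
theorem polTensor_expChart_crossMul [DecidableEq Λ] [DecidableEq T] (c : ℝ) (μ₁ : Λ) (x₁ : T) (μ₂ : Λ) (x₂ : T)
    (μ : Λ) (x : T) (v : ℝ) (ν : Λ) (y : T) (w : ℝ) :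
    polTensor ℝ (expChart (F := ℝ) (fun W : Λ → T → ℝ => c * (W μ₁ x₁ * W μ₂ x₂)) (ContinuousLinearMap.id ℝ ℝ)) μ x v ν y w =
      c * (((Pi.single μ (Pi.single x v) : Λ → T → ℝ) μ₁ x₁ + (Pi.single μ (Pi.single x v) : Λ → T → ℝ) μ₂ x₂) *
        ((Pi.single ν (Pi.single y w) : Λ → T → ℝ) μ₁ x₁ + (Pi.single ν (Pi.single y w) : Λ → T → ℝ) μ₂ x₂)) := by
  rw [B12PolarizationTensor120.polTensor_def, expChart_crossMul, (hasFDerivAt_fderiv_constMulExp c _).fderiv]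
  simp
  ring

end Calculus

/-! ## §2 The mixed two-bond family with an ARBITRARY amplitude law `a : HBeta`: windowed kernels, the (1.21) limit and the (1.22) β in closed form -/

section Model

/-- **THE CLOSED-FORM LIMITING KERNEL**: amplitude `c` times the product of §1's two «which bond» indicator sums read at the window pair `(z, 0)`:
`c · ([μ = 0 ∧ z = e] + [μ = 1 ∧ z = 0]) · ([ν = 0 ∧ e = 0] + [ν = 1])`; its MIXED entry is `Π₀₁(z) = c·[z = e]`. [cite: Balaban1987RG1, (1.21) p.264; model] -/
def crossKernel (c : ℝ) (e : Fin 4 → ℤ) : B12Beta.Kernel 4 := fun μ ν z =>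
  c * (((if μ = 0 ∧ z = e then 1 else 0) + (if μ = 1 ∧ z = 0 then 1 else 0)) * ((if ν = 0 ∧ e = 0 then 1 else 0) + (if ν = 1 then 1 else 0)))

/-- The kernel is LINEAR in the amplitude. [folklore] -/
theorem crossKernel_sub (c c' : ℝ) (e : Fin 4 → ℤ) (μ ν : Fin 4) (z : Fin 4 → ℤ) :
    crossKernel c e μ ν z - crossKernel c' e μ ν z = crossKernel (c - c') e μ ν z := by
  unfold crossKernel; ring

/-- **THE MIXED ENTRY**: `Π₀₁(z) = c · [z = e]`. [cite: Balaban1987RG1, (1.21)–(1.22) p.264; model] -/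
theorem crossKernel_zero_one (c : ℝ) (e z : Fin 4 → ℤ) : crossKernel c e 0 1 z = if z = e then c else 0 := by
  have h01 : ¬ ((0 : Fin 4) = 1) := by decide
  have h10 : ¬ ((1 : Fin 4) = 0) := by decide
  unfold crossKernel
  by_cases hz : z = e <;> simp [hz, h01, h10]

/-- The shape factor is at most `4`: `|crossKernel c e μ ν z| ≤ 4|c|`. [folklore] -/
theorem abs_crossKernel_le_four (c : ℝ) (e : Fin 4 → ℤ) (μ ν : Fin 4) (z : Fin 4 → ℤ) : |crossKernel c e μ ν z| ≤ 4 * |c| := by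
  have h1 : ∀ (P Q : Prop) [Decidable P] [Decidable Q], |((if P then (1 : ℝ) else 0) + (if Q then 1 else 0))| ≤ 2 := by
    intro P Q _ _
    split_ifs <;> norm_num
  unfold crossKernel
  rw [abs_mul, abs_mul, mul_comm (4 : ℝ)]
  refine mul_le_mul_of_nonneg_left ?_ (abs_nonneg c)
  calc _ ≤ (2 : ℝ) * 2 := mul_le_mul (h1 _ _) (h1 _ _) (abs_nonneg _) (by norm_num)
    _ = 4 := by norm_num

/-- The kernel is SUPPORTED ON `{e, 0}`. [folklore] -/
theorem crossKernel_eq_zero_of_ne {c : ℝ} {e z : Fin 4 → ℤ} (hze : z ≠ e) (hz0 : z ≠ 0) (μ ν : Fin 4) : crossKernel c e μ ν z = 0 := by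
  unfold crossKernel
  simp [hze, hz0]

/-- **THE SUPPORT WEIGHT** `wt κ e := 4·(1 + e^{κ|e|₁})`, converting the `{e, 0}`-support into a (5.10)-type decay bound at ANY rate `κ`. [folklore] -/
def wt (κ : ℝ) (e : Fin 4 → ℤ) : ℝ := 4 * (1 + Real.exp (κ * l1 e))

/-- `0 ≤ wt κ e`. [folklore] -/
theorem wt_nonneg (κ : ℝ) (e : Fin 4 → ℤ) : 0 ≤ wt κ e := by unfold wt; positivity

/-- ★ **THE DECAY SHAPE OF THE CLOSED-FORM KERNEL AT ANY RATE**: `|crossKernel c e μ ν z| ≤ |c| · wt κ e · e^{−κ|z|₁}`. [cite: Balaban1987RG1, (5.10) p.293; model] -/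
theorem abs_crossKernel_le (c : ℝ) (e : Fin 4 → ℤ) (μ ν : Fin 4) (z : Fin 4 → ℤ) (κ : ℝ) :
    |crossKernel c e μ ν z| ≤ |c| * wt κ e * Real.exp (-(κ * l1 z)) := by
  have h4 := abs_crossKernel_le_four c e μ ν z
  have hc := abs_nonneg c
  have hE : 0 ≤ Real.exp (κ * l1 e) := Real.exp_nonneg _
  by_cases hz0 : z = 0
  · subst hz0
    have h0 : l1 (0 : Fin 4 → ℤ) = 0 := by simp [l1]
    rw [h0, mul_zero, neg_zero, Real.exp_zero, mul_one]
    unfold wt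
    nlinarith [mul_nonneg hc hE]
  by_cases hze : z = e
  · subst hze
    unfold wt
    have hprod : Real.exp (κ * l1 z) * Real.exp (-(κ * l1 z)) = 1 := by rw [← Real.exp_add, add_neg_cancel, Real.exp_zero]
    have hE' : 0 ≤ Real.exp (-(κ * l1 z)) := Real.exp_nonneg _
    nlinarith [mul_nonneg hc hE', mul_nonneg (mul_nonneg hc hE') hE]
  · rw [crossKernel_eq_zero_of_ne hze hz0, abs_zero]
    exact mul_nonneg (mul_nonneg hc (wt_nonneg κ e)) (Real.exp_nonneg _)

variable (F : T4Family)

/-- **THE MIXED TWO-BOND TERM FAMILY WITH AMPLITUDE LAW `a`** (scalar model, `𝔄 = ℝ`): at level `k`, history `v`, volume `K`, the functional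
`W ↦ a k v · W 0 x_e · W 1 x_0` of scalar bond configurations of `T^{(k+1)}_K`, with `x_e ∕ x_0` the window images of `e ∕ 0 ∈ ℤ⁴` — a direction-`0` bond at `e`
COUPLED to the direction-`1` bond at the origin, weighted by an ARBITRARY history-dependent amplitude `a : HBeta`. [cite: Balaban1988RG2Cluster, (2.13) p.14; model] -/
def crossTermFamily (a : HBeta) (e : Fin 4 → ℤ) : TermFamily1 F ℝ :=
  fun k v K W => a k v * (W (Fin.cast (F.P_d K).symm 0) (siteOfInt F K (k + 1) e) * W (Fin.cast (F.P_d K).symm 1) (siteOfInt F K (k + 1) 0))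

/-- The window is additive: `x_{z − z'} = x_z − x_{z'}`. [folklore] -/
theorem siteOfInt_sub (K j : ℕ) (z z' : Fin 4 → ℤ) : siteOfInt F K j (z - z') = siteOfInt F K j z - siteOfInt F K j z' := by
  funext i
  show _ = siteOfInt F K j z i - siteOfInt F K j z' i
  simp [siteOfInt]

/-- The window sends `0` to the torus origin. [folklore] -/
theorem siteOfInt_zero (K j : ℕ) : siteOfInt F K j 0 = 0 := by
  funext i
  show _ = (0 : ZMod ((F.P K).sitesPerDir j))
  simp [siteOfInt]

/-- **THE TORUS WINDOW SEPARATES ANY TWO DISTINCT INTEGER VECTORS EVENTUALLY IN THE VOLUME** (dag-n18-w2 g6's `siteOfInt_eventually_ne` at `z − z'`).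
[cite: Balaban1987RG1, (1.21) p.264; model] -/
theorem siteOfInt_eventually_ne_of_ne (j : ℕ) {z z' : Fin 4 → ℤ} (hz : z ≠ z') : ∀ᶠ K in atTop, siteOfInt F K j z ≠ siteOfInt F K j z' := by
  filter_upwards [siteOfInt_eventually_ne F j (sub_ne_zero.2 hz)] with K hK h
  exact hK (by rw [siteOfInt_sub, h, sub_self, siteOfInt_zero])

/-- Eventually in the volume, «same window image» IS «same integer vector». [cite: Balaban1987RG1, (1.21) p.264; model] -/
theorem siteOfInt_eventually_eq_iff (j : ℕ) (z z' : Fin 4 → ℤ) : ∀ᶠ K in atTop, (siteOfInt F K j z = siteOfInt F K j z' ↔ z = z') := by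
  by_cases hz : z = z'
  · subst hz
    exact Eventually.of_forall fun K => by simp
  · filter_upwards [siteOfInt_eventually_ne_of_ne F j hz] with K hK
    exact ⟨fun h => (hK h).elim, fun h => (hz h).elim⟩

/-- **THE WINDOWED KERNEL AT FINITE VOLUME** (chart `ρ = id`, basis `Module.Basis.singleton Unit ℝ`), in indicator form on the window images.
[cite: Balaban1987RG1, (1.20)–(1.21) p.264; model] -/
theorem polWindow_crossTermFamily (a : HBeta) (e : Fin 4 → ℤ) (k : ℕ) (v : Fin (k + 1) → ℝ) (K : ℕ) (μ ν : Fin 4) (z : Fin 4 → ℤ) :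
    polWindow F K (k + 1) (crossTermFamily F a e k v K) (ContinuousLinearMap.id ℝ ℝ) (Module.Basis.singleton Unit ℝ) μ ν z =
      a k v *
        (((if μ = 0 ∧ siteOfInt F K (k + 1) z = siteOfInt F K (k + 1) e then 1 else 0) +
            (if μ = 1 ∧ siteOfInt F K (k + 1) z = siteOfInt F K (k + 1) 0 then 1 else 0)) *
          ((if ν = 0 ∧ siteOfInt F K (k + 1) 0 = siteOfInt F K (k + 1) e then 1 else 0) + (if ν = 1 then 1 else 0))) := by
  unfold polWindow polScalar crossTermFamily
  simp only [polComp, Module.Basis.singleton_apply, Fintype.card_unique, Nat.cast_one, inv_one, one_mul, Finset.univ_unique,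
    Finset.sum_singleton, polTensor_expChart_crossMul, single_single_apply]
  have hcast : ∀ a μ' : Fin 4, (Fin.cast (F.P_d K).symm μ' = Fin.cast (F.P_d K).symm a) ↔ μ' = a := fun a μ' =>
    ⟨fun h => Fin.cast_injective _ h, fun h => by rw [h]⟩
  simp only [hcast, and_true]

/-- ★ **EVENTUALLY IN THE VOLUME THE WINDOWED KERNEL IS THE CLOSED-FORM KERNEL** `crossKernel (a k v) e`. [cite: Balaban1987RG1, (1.20)–(1.21) p.264; model] -/
theorem polWindow_crossTermFamily_eventually (a : HBeta) (e : Fin 4 → ℤ) (k : ℕ) (v : Fin (k + 1) → ℝ) (μ ν : Fin 4) (z : Fin 4 → ℤ) :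
    ∀ᶠ K in atTop, polWindow F K (k + 1) (crossTermFamily F a e k v K) (ContinuousLinearMap.id ℝ ℝ) (Module.Basis.singleton Unit ℝ) μ ν z =
      crossKernel (a k v) e μ ν z := by
  have h4 : ((0 : Fin 4 → ℤ) = e) ↔ (e = 0) := eq_comm
  filter_upwards [siteOfInt_eventually_eq_iff F (k + 1) z e, siteOfInt_eventually_eq_iff F (k + 1) z 0,
    siteOfInt_eventually_eq_iff F (k + 1) 0 e] with K h1 h2 h3
  rw [polWindow_crossTermFamily]
  unfold crossKernel
  simp only [h1, h2, h3, h4]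

/-- The windowed kernels CONVERGE (to the closed-form kernel) as `K → ∞`. [cite: Balaban1987RG1, (1.21) p.264; model] -/
theorem tendsto_polWindow_crossTermFamily (a : HBeta) (e : Fin 4 → ℤ) (k : ℕ) (v : Fin (k + 1) → ℝ) (μ ν : Fin 4) (z : Fin 4 → ℤ) :
    Tendsto (fun K : ℕ => polWindow F K (k + 1) (crossTermFamily F a e k v K) (ContinuousLinearMap.id ℝ ℝ) (Module.Basis.singleton Unit ℝ) μ ν z) atTop
      (𝓝 (crossKernel (a k v) e μ ν z)) := by
  have h : (fun K : ℕ => polWindow F K (k + 1) (crossTermFamily F a e k v K) (ContinuousLinearMap.id ℝ ℝ) (Module.Basis.singleton Unit ℝ) μ ν z)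
      =ᶠ[atTop] fun _ => crossKernel (a k v) e μ ν z :=
    polWindow_crossTermFamily_eventually F a e k v μ ν z
  exact tendsto_const_nhds.congr' h.symm

/-- **THE (1.21) LIMIT IN CLOSED FORM**: def-B's `polLimit` of the model at history `v` IS `crossKernel (a k v) e`. [cite: Balaban1987RG1, (1.21) p.264; model] -/
theorem polLimit_crossTermFamily (a : HBeta) (e : Fin 4 → ℤ) (k : ℕ) (v : Fin (k + 1) → ℝ) (μ ν : Fin 4) (z : Fin 4 → ℤ) :
    polLimit F (k + 1) (fun K => crossTermFamily F a e k v K) (ContinuousLinearMap.id ℝ ℝ) (Module.Basis.singleton Unit ℝ) μ ν z =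
      crossKernel (a k v) e μ ν z :=
  (tendsto_polWindow_crossTermFamily F a e k v μ ν z).limUnder_eq

/-- The (1.21)-existence property of def-B at every level and history of the model (the windowed kernels are eventually constant). [cite: Balaban1987RG1, (1.21) p.264; model] -/
theorem polLimitExists_crossTermFamily (a : HBeta) (e : Fin 4 → ℤ) (k : ℕ) (v : Fin (k + 1) → ℝ) :
    PolLimitExists F (k + 1) (fun K => crossTermFamily F a e k v K) (ContinuousLinearMap.id ℝ ℝ) (Module.Basis.singleton Unit ℝ) := fun μ ν z =>
  ⟨_, tendsto_polWindow_crossTermFamily F a e k v μ ν z⟩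

/-- W1-19's limiting kernel `kernelA` of the model at a coupling sequence `g`. [cite: Balaban1987RG1, (1.21) p.264; model] -/
theorem kernelA_crossTermFamily (a : HBeta) (e : Fin 4 → ℤ) (g : ℕ → ℝ) (k : ℕ) (μ ν : Fin 4) (z : Fin 4 → ℤ) :
    kernelA F (crossTermFamily F a e) (ContinuousLinearMap.id ℝ ℝ) (Module.Basis.singleton Unit ℝ) g k μ ν z = crossKernel (a k (histPrefix g k)) e μ ν z :=
  polLimit_crossTermFamily F a e k (histPrefix g k) μ ν z

/-- ★★ **THE MODEL's (1.22) β IN CLOSED FORM**: def-B's `betaMerged` (the second moment `Σ_z Π₀₁(z) z₀ z₁` of the limiting kernel) of the two-bond family with amplitude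
law `a` IS `(k, v) ↦ a k v · e₀ · e₁` (`tsum_eq_single e`: the mixed entry lives at `z = e`). [cite: Balaban1987RG1, (1.22) p.264; model] -/
theorem betaMerged_crossTermFamily (a : HBeta) (e : Fin 4 → ℤ) :
    betaMerged F (crossTermFamily F a e) (ContinuousLinearMap.id ℝ ℝ) (Module.Basis.singleton Unit ℝ) = fun k v => a k v * ((e 0 : ℝ) * e 1) := by
  funext k v
  unfold betaMerged B12Beta.secondMoment
  simp only [polLimit_crossTermFamily, crossKernel_zero_one]
  rw [tsum_eq_single e (fun z hz => by simp [hz])]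
  simp [mul_assoc]

/-- **THE DIAGONAL SEPARATION** `e = (1, 1, 0, 0)` (so that `e₀ · e₁ = 1`). [folklore] -/
def diag01 : Fin 4 → ℤ := ![1, 1, 0, 0]

/-- `diag01 0 * diag01 1 = 1` (in `ℝ`). [folklore] -/
@[simp] theorem diag01_mul : ((diag01 0 : ℤ) : ℝ) * diag01 1 = 1 := by simp [diag01]

/-- ★★★ **REALIZATION: EVERY HISTORY-DEPENDENT β-FUNCTION IS THE (1.22) β OF A SCALAR TERM FAMILY** — def-B's β-map `ℰ ↦ betaMerged F ℰ ρ bV` (the (1.20) Hessian of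
the chart, the (1.21) window-and-limit, the (1.22) second moment) is ONTO `HBeta` at model level: for every `β : HBeta`, the two-bond family at the diagonal separation with
amplitude law `β` has `betaMerged = β`.  So NO β-side letter (sign, running, anchoring, non-degeneracy, one-sided limits) is excluded by the SHAPE of def-B's definitions;
every such letter is CONTENT about Bałaban's specific merged term (1.6), as g2 located for № 13. [cite: Balaban1987RG1, (1.20)–(1.22) p.264; model] -/
theorem betaMerged_crossTermFamily_diag01 (β : HBeta) :
    betaMerged F (crossTermFamily F β diag01) (ContinuousLinearMap.id ℝ ℝ) (Module.Basis.singleton Unit ℝ) = β := by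
  rw [betaMerged_crossTermFamily]
  funext k v
  rw [diag01_mul, mul_one]

/-- The same, as an existence statement over def-B's INPUT TYPE. [cite: Balaban1987RG1, (1.20)–(1.22) p.264; model] -/
theorem exists_termFamily_betaMerged_eq (β : HBeta) :
    ∃ ℰ : TermFamily1 F ℝ, betaMerged F ℰ (ContinuousLinearMap.id ℝ ℝ) (Module.Basis.singleton Unit ℝ) = β :=
  ⟨crossTermFamily F β diag01, betaMerged_crossTermFamily_diag01 F β⟩

end Model

/-! ## §3 β-side letters TRANSPORTED to the term-family level (the model's `betaMerged` IS the prescribed `β`) -/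

section BetaSide

variable (F : T4Family)

/-- def-B's β of record in the split shape over the model IS the split shape over `β`. [cite: Balaban1987RG1, (1.22) p.264 and (2.12)–(2.14) p.268; model] -/
theorem betaOfMerged_crossTermFamily_diag01 (β : HBeta) (β0 : ℕ → ℝ) (γ : ℝ) :
    betaOfMerged (betaMerged F (crossTermFamily F β diag01) (ContinuousLinearMap.id ℝ ℝ) (Module.Basis.singleton Unit ℝ)) β0 γ = betaOfMerged β β0 γ := by
  rw [betaMerged_crossTermFamily_diag01]

/-- The model's one-loop numbers `beta0OfMerged` ARE those of `β`. [cite: Balaban1987RG1, (2.12)–(2.14) p.268; model] -/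
theorem beta0OfMerged_crossTermFamily_diag01 (β : HBeta) (v₀ : (k : ℕ) → (Fin (k + 1) → ℝ)) :
    beta0OfMerged (betaMerged F (crossTermFamily F β diag01) (ContinuousLinearMap.id ℝ ℝ) (Module.Basis.singleton Unit ℝ)) v₀ = beta0OfMerged β v₀ := by
  rw [betaMerged_crossTermFamily_diag01]

/-- ★ **A RUNNING β IS REALIZED**: `¬ BoxwiseConstant γ β` for the prescribed law gives `¬ BoxwiseConstant γ (betaMerged F (crossTermFamily F β diag01) …)` — the
positive twin of dag-n18-w2 g6's `boxwiseConstant_betaMerged_fading` (there β ≡ 0). [folklore] -/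
theorem not_boxwiseConstant_betaMerged_cross {γ : ℝ} {β : HBeta} (h : ¬ BoxwiseConstant γ β) :
    ¬ BoxwiseConstant γ (betaMerged F (crossTermFamily F β diag01) (ContinuousLinearMap.id ℝ ℝ) (Module.Basis.singleton Unit ℝ)) := by
  rwa [betaMerged_crossTermFamily_diag01]

/-- … and in the split currency of p592505 ∕ g2 (`betaOfMerged (betaMerged …) β0 γ`, ANY one-loop numbers `β0`; on the boxes the split β IS the merged β). [folklore] -/
theorem not_boxwiseConstant_betaOfMerged_cross {γ : ℝ} {β : HBeta} (h : ¬ BoxwiseConstant γ β) (β0 : ℕ → ℝ) :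
    ¬ BoxwiseConstant γ (betaOfMerged (betaMerged F (crossTermFamily F β diag01) (ContinuousLinearMap.id ℝ ℝ) (Module.Basis.singleton Unit ℝ)) β0 γ) := by
  rw [betaOfMerged_crossTermFamily_diag01]
  intro hc
  refine h fun k v v' hv hv' => ?_
  have := hc k v v' hv hv'
  rwa [Node00.betaOfMerged_of_mem _ _ _ hv, Node00.betaOfMerged_of_mem _ _ _ hv'] at this

/-- g2's missing letter `RemainderNonvanishingOnBoxes` TRANSPORTED: if `β` differs from `b` somewhere on the boxes, so does the model's `betaMerged`. [folklore] -/
theorem remainderNonvanishingOnBoxes_cross {γ : ℝ} {β : HBeta} {b : ℕ → ℝ} (h : RemainderNonvanishingOnBoxes γ β b) :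
    RemainderNonvanishingOnBoxes γ (betaMerged F (crossTermFamily F β diag01) (ContinuousLinearMap.id ℝ ℝ) (Module.Basis.singleton Unit ℝ)) b := by
  rwa [betaMerged_crossTermFamily_diag01]

/-- def-B's named clause `Beta0LimitExists` TRANSPORTED. [cite: Balaban1987RG1, (2.12)–(2.14) p.268; model] -/
theorem beta0LimitExists_cross {β : HBeta} {v₀ : (k : ℕ) → (Fin (k + 1) → ℝ)} (h : Beta0LimitExists β v₀) :
    Beta0LimitExists (betaMerged F (crossTermFamily F β diag01) (ContinuousLinearMap.id ℝ ℝ) (Module.Basis.singleton Unit ℝ)) v₀ := by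
  rwa [betaMerged_crossTermFamily_diag01]

/-- ★ **p592505's GUARD LEMMA APPLIED WITH AN INHABITED ANTECEDENT** (№189 A6 for `sensitiveOnBoxes_objects_of_not_boxwiseConstant`): at the model built on ANY law `β`
that is not boxwise constant, node U3's kernel objects PASS n18-w2 g0's coupling-sensitivity guard — non-vacuously. [folklore] -/
theorem sensitiveOnBoxes_objects_cross {γ : ℝ} {β : HBeta} (h : ¬ BoxwiseConstant γ β) (ℓ : U3Letters₁₁) (β0 : ℕ → ℝ) (k : ℕ) :
    SensitiveOnBoxes ((objects F (crossTermFamily F β diag01) (ContinuousLinearMap.id ℝ ℝ) (Module.Basis.singleton Unit ℝ) ℓ).EA k) γ :=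
  YMDAG.N18.U3GuardsAtKernels.sensitiveOnBoxes_objects_of_not_boxwiseConstant F _ _ _ ℓ β0 γ k (not_boxwiseConstant_betaOfMerged_cross F h β0)

/-- **THE LINEAR LAW** `β k v := b k + v_k` (g2's abstract A6 witness `exists_anchor_and_remainderNonvanishingOnBoxes`) NOW AT THE TERM-FAMILY LEVEL: for every reference
sequence `b` and window `γ > 0` there is a scalar term family whose def-B β is anchored at `b` near the zero history, has non-vanishing remainder on the window, and is
not boxwise constant. [folklore] -/
theorem exists_termFamily_anchor_and_remainderNonvanishingOnBoxes (b : ℕ → ℝ) {γ : ℝ} (hγ : 0 < γ) :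
    ∃ ℰ : TermFamily1 F ℝ,
      (∀ (k : ℕ) (δ : ℝ), 0 < δ → ∃ γ' : ℝ, 0 < γ' ∧ ∀ p : Fin (k + 1) → ℝ, p ∈ HistBox γ' k →
          |betaMerged F ℰ (ContinuousLinearMap.id ℝ ℝ) (Module.Basis.singleton Unit ℝ) k p - b k| ≤ δ) ∧
        RemainderNonvanishingOnBoxes γ (betaMerged F ℰ (ContinuousLinearMap.id ℝ ℝ) (Module.Basis.singleton Unit ℝ)) b ∧
          ¬ BoxwiseConstant γ (betaMerged F ℰ (ContinuousLinearMap.id ℝ ℝ) (Module.Basis.singleton Unit ℝ)) := by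
  obtain ⟨β, hA, hR, hB⟩ := YMDAG.N18.BetaBoxDegeneracy.exists_anchor_and_remainderNonvanishingOnBoxes b hγ
  exact ⟨crossTermFamily F β diag01, by rw [betaMerged_crossTermFamily_diag01]; exact ⟨hA, hR, hB⟩⟩

end BetaSide

end YMDAG.N18.RunningBetaLettersModel

end
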